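import Mathlib
import Literature.MathematicalPhysics.StatisticalMechanics.HaggStacking
import Summits.AtomisticToContinuum.Crystallization.Theorems.PricedLinkCensusStackingHingeHaggDominationAllRanges
import Summits.AtomisticToContinuum.Crystallization.Theses.OneCrossingRisingSea

/-!
# Crux `HcpLandscapeGap` (route HullExactificationCascade, item stmt-AtomisticToContinuum-12087),
# line `birth`/`registered`, skeleton v4 — stub (S) `stub_dominatedRegistrySelectsHcp`

**Dominated registry couplings select hcp** (infinite volume).  For a coupling sequence
`J : ℕ → ℝ` with `Σ k|J_k| < ∞` and the domination hypothesis `J₂ + Σ_{k ≥ 3} (k − 1)|J_k| ≤ 0`, the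
alternating Hägg word `ABAB…` (hcp) minimises the stacking energy density
`haggStackingEnergy J s = liminf_n H_n(J, s)/n` over ALL Hägg words `s` (`±1` sequences): the value
`h(J, ABAB…) = Σ_{k ≥ 2 even} J_k` (`haggStackingEnergy_alternating`) is a least element of the range.

This is verbatim
* stub (S) of the registered skeletons `Cruxes/HcpBulkFloor/Lines/birth.lean` (crux stmt-14477),
  `Cruxes/HcpPeriodicMinimiser/Lines/birth.lean` (item stmt-3061) and of skeleton v4 of this line
  (`Cruxes/HcpLandscapeGap/Lines/birth.lean`), and
* the support item `OneCrossingRisingSea.DominatedRegistrySelectsHcp` (stmt-AtomisticToContinuum-12054).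

Proof.  The finite-volume core is the landed Hägg domination at all ranges
(`PricedHcpWindowsHaggDomination.stub_haggDominationAllRanges`, item 0737):
`n · Σ_{even} J_k ≤ H_n(J, s) + C` with `C = Σ_k k|J_k|`, for every `n`.  Dividing by `n ≥ 1` gives
`Σ_{even} J_k − C/n ≤ H_n(J,s)/n`; the left side tends to `Σ_{even} J_k`, and `|H_n(J,s)/n| ≤ C`
(termwise `|J_k 1[…]| ≤ k|J_k|`), so monotonicity of `liminf` along `atTop` (with the boundedness
side conditions of the conditionally complete lattice `ℝ`) gives `Σ_{even} J_k ≤ liminf_n H_n(J,s)/n`.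
All `[folklore]`.
-/

namespace Summit.AtomisticToContinuum.Crystallization.Theorems.HcpLandscapeGapBirth

open Filter Finset Topology
open Literature.MathematicalPhysics.StatisticalMechanics

/-- Termwise bound: `|J_k · 1[2 ≤ k ∧ P k]| ≤ k |J_k|`. [folklore] -/
theorem abs_ite_coupling_le (J : ℕ → ℝ) (P : ℕ → Prop) [DecidablePred P] (k : ℕ) :
    ‖(if 2 ≤ k ∧ P k then J k else 0)‖ ≤ (k : ℝ) * |J k| := by
  by_cases h : 2 ≤ k ∧ P k
  · rw [if_pos h, Real.norm_eq_abs]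
    have hk : (1 : ℝ) ≤ k := by exact_mod_cast (show 1 ≤ k by omega)
    nlinarith [abs_nonneg (J k)]
  · rw [if_neg h, norm_zero]
    positivity

/-- The local stacking energy is bounded by `Σ_k k|J_k|`. [folklore] -/
theorem abs_haggLocalEnergy_le {J : ℕ → ℝ} (hsum : Summable (fun k : ℕ => (k : ℝ) * |J k|))
    (s : ℤ → ℤ) (m : ℤ) :
    |haggLocalEnergy J s m| ≤ ∑' k : ℕ, (k : ℝ) * |J k| := by
  rw [← Real.norm_eq_abs]
  unfold haggLocalEnergy
  exact tsum_of_norm_bounded hsum.hasSum (fun k => abs_ite_coupling_le J (fun k => HaggAligned s m k) k)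

/-- The finite-volume stacking energy is bounded by `n · Σ_k k|J_k|`. [folklore] -/
theorem abs_haggEnergy_le {J : ℕ → ℝ} (hsum : Summable (fun k : ℕ => (k : ℝ) * |J k|))
    (s : ℤ → ℤ) (n : ℕ) :
    |haggEnergy n J s| ≤ n * ∑' k : ℕ, (k : ℝ) * |J k| := by
  unfold haggEnergy
  calc |∑ m ∈ range n, haggLocalEnergy J s m|
      ≤ ∑ m ∈ range n, |haggLocalEnergy J s m| := abs_sum_le_sum_abs _ _
    _ ≤ ∑ _m ∈ range n, ∑' k : ℕ, (k : ℝ) * |J k| :=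
        sum_le_sum fun m _ => abs_haggLocalEnergy_le hsum s m
    _ = n * ∑' k : ℕ, (k : ℝ) * |J k| := by simp

/-- The per-layer energy `H_n(J,s)/n` is bounded by `Σ_k k|J_k|` in absolute value. [folklore] -/
theorem abs_haggEnergy_div_le {J : ℕ → ℝ} (hsum : Summable (fun k : ℕ => (k : ℝ) * |J k|))
    (s : ℤ → ℤ) (n : ℕ) :
    |haggEnergy n J s / n| ≤ ∑' k : ℕ, (k : ℝ) * |J k| := by
  rcases Nat.eq_zero_or_pos n with rfl | hn
  · simp only [Nat.cast_zero, div_zero, abs_zero]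
    exact tsum_nonneg fun k => by positivity
  · have hn' : (0 : ℝ) < n := by exact_mod_cast hn
    rw [abs_div, abs_of_pos hn', div_le_iff₀ hn', mul_comm]
    exact abs_haggEnergy_le hsum s n

/-- The finite-volume Hägg domination (landed item 0737) in the vocabulary of `haggEnergy`:
`n · Σ_{k ≥ 2 even} J_k ≤ H_n(J, s) + Σ_k k|J_k|`. [folklore] -/
theorem haggDomination_haggEnergy {J : ℕ → ℝ} {s : ℤ → ℤ} (hs : IsHaggSeq s)
    (hsum : Summable (fun k : ℕ => (k : ℝ) * |J k|))
    (hdom : J 2 + ∑' k : ℕ, (if 3 ≤ k then ((k : ℝ) - 1) * |J k| else 0) ≤ 0) (n : ℕ) :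
    (n : ℝ) * (∑' k : ℕ, (if 2 ≤ k ∧ Even k then J k else 0)) ≤
      haggEnergy n J s + ∑' k : ℕ, (k : ℝ) * |J k| :=
  Summit.AtomisticToContinuum.Crystallization.Theorems.PricedHcpWindowsHaggDomination.stub_haggDominationAllRanges
    J s n hs hsum hdom

/-- **The alternating word is below every Hägg word in stacking energy density** under domination.
[folklore] -/
theorem haggStackingEnergy_alternating_le {J : ℕ → ℝ} {s : ℤ → ℤ} (hs : IsHaggSeq s)
    (hsum : Summable (fun k : ℕ => (k : ℝ) * |J k|))
    (hdom : J 2 + ∑' k : ℕ, (if 3 ≤ k then ((k : ℝ) - 1) * |J k| else 0) ≤ 0) :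
    haggStackingEnergy J alternatingHagg ≤ haggStackingEnergy J s := by
  set E : ℝ := ∑' k : ℕ, (if 2 ≤ k ∧ Even k then J k else 0) with hE
  set C : ℝ := ∑' k : ℕ, (k : ℝ) * |J k| with hC
  rw [haggStackingEnergy_alternating, haggStackingEnergy]
  -- comparison sequence `v n = E − C/n → E`
  have hv : Tendsto (fun n : ℕ => E - C / n) atTop (𝓝 E) := by
    simpa using (tendsto_const_nhds (x := E)).sub (tendsto_const_div_atTop_nhds_zero_nat C)
  have hle : ∀ᶠ n : ℕ in atTop, E - C / n ≤ haggEnergy n J s / n := by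
    filter_upwards [eventually_ge_atTop 1] with n hn
    have hn' : (0 : ℝ) < n := by exact_mod_cast hn
    have h := haggDomination_haggEnergy hs hsum hdom n
    rw [sub_le_iff_le_add, ← add_div, le_div_iff₀ hn', mul_comm]
    exact h
  have hbdd : IsBoundedUnder (· ≤ ·) atTop (fun n : ℕ => haggEnergy n J s / n) :=
    isBoundedUnder_of ⟨C, fun n : ℕ => (le_abs_self _).trans (abs_haggEnergy_div_le hsum s n)⟩
  calc E = liminf (fun n : ℕ => E - C / n) atTop := hv.liminf_eq.symm
    _ ≤ liminf (fun n : ℕ => haggEnergy n J s / n) atTop :=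
        liminf_le_liminf hle hv.isBoundedUnder_ge hbdd.isCoboundedUnder_ge

/-- **Stub (S) — dominated registry couplings select hcp** (verbatim stub (S) of skeleton v4 of line
`birth` of crux stmt-AtomisticToContinuum-12087, of `Cruxes/HcpBulkFloor/Lines/birth.lean` (crux 14477)
and `Cruxes/HcpPeriodicMinimiser/Lines/birth.lean` (item 3061), and the statement of the support item
`OneCrossingRisingSea.DominatedRegistrySelectsHcp`, stmt-AtomisticToContinuum-12054): for every coupling
sequence `J` with `Σ k|J_k| < ∞` and `J₂ + Σ_{k≥3}(k−1)|J_k| ≤ 0`, the alternating Hägg word minimises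
`haggStackingEnergy J` over all Hägg words. [folklore] -/
theorem stub_dominatedRegistrySelectsHcp : ∀ J : ℕ → ℝ, Summable (fun k : ℕ => (k : ℝ) * |J k|) → J 2 + ∑' k : ℕ, (if 3 ≤ k then ((k : ℝ) - 1) * |J k| else 0) ≤ 0 → IsLeast (Set.range fun s : {s : ℤ → ℤ // Literature.MathematicalPhysics.StatisticalMechanics.IsHaggSeq s} => Literature.MathematicalPhysics.StatisticalMechanics.haggStackingEnergy J s.1) (Literature.MathematicalPhysics.StatisticalMechanics.haggStackingEnergy J Literature.MathematicalPhysics.StatisticalMechanics.alternatingHagg) := by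
  intro J hsum hdom
  refine ⟨⟨⟨alternatingHagg, isHaggSeq_alternating⟩, rfl⟩, ?_⟩
  rintro _ ⟨⟨s, hs⟩, rfl⟩
  exact haggStackingEnergy_alternating_le hs hsum hdom

/-- The support item `OneCrossingRisingSea.DominatedRegistrySelectsHcp` (stmt-AtomisticToContinuum-12054)
BY NAME — its statement is literally the signature of `stub_dominatedRegistrySelectsHcp`. [folklore] -/
theorem dominatedRegistrySelectsHcp_proof :
    Summit.AtomisticToContinuum.Crystallization.Theses.OneCrossingRisingSea.DominatedRegistrySelectsHcp :=
  stub_dominatedRegistrySelectsHcp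

end Summit.AtomisticToContinuum.Crystallization.Theorems.HcpLandscapeGapBirth
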